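import Summits.Ventures.CertifiedQuantumChemistry.Rows.OrbitalRotationCovarianceT
import Summits.Ventures.CertifiedQuantumChemistry.Rows.OrbitalRotationAveraging
import HarnessLib

/-!
# Ventures/CertifiedQuantumChemistry — Rows/OrbitalRotationInvarianceT.lean: the sector `PQGT1T2′`
# programme and its optimal values are INVARIANT under orbital rotations; symmetry adaptation at the
# `T1`/`T2′` rung is LOSSLESS

HONEST FRAMING (verbatim): certified bounds for a stated model Hamiltonian in a stated basis; not a
claim about the real molecule beyond that model.

Seat rdm-B, ROWS courtesy file (theorems only; no `def`, no notation); the `T1`/`T2′` rung of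
`Rows/OrbitalRotationInvariance.lean` and `Rows/OrbitalRotationAveraging.lean` — the rung of the
cell's strongest certified rows (`DQGT1T2′`):

* **`isDQGT1T2PrimeFeasibleSector_conj_unitary`** — the `S_z`-sector `PQGT1T2′`-feasible set is
  INVARIANT under every spin-preserving unitary rotation of the spin orbitals (`U U† = 1`,
  `U_{iσ,kτ} = 0` for `σ ≠ τ`);
* **`pqgT1T2pSectorEnergy_conj_orbital`**, **`pqgT1T2pEnergy_conj_orbital`** — the optimal values
  `E_PQGT1T2′(N_α, N_β)` and `E_PQGT1T2′(N)` are ORBITAL-ROTATION INVARIANTS of the integral tables: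
  for a unitary `u` on `Λ` with spin-free lift `U`, the value for `(h, g)` equals the value for the
  rotated tables `h'_{ab} = Σ_{pq} u_{pa} ū_{qb} h_{pq}`, `g'_{abcd} = Σ_{pqrs} u_{pa} ū_{qb} u_{rc} ū_{sd} g_{pqrs}`
  (`rdmEnergy_conj_orbital`);
* `isDQGT1T2PrimeFeasible_rotationAverage`, `isDQGT1T2PrimeFeasibleSector_rotationAverage`,
  **`le_pqgT1T2pEnergy_iff_rotationInvariant`**, **`le_pqgT1T2pSectorEnergy_iff_rotationInvariant`**,
  `exists_rotationInvariant_rdmEnergy_eq_pqgT1T2pSectorEnergy` — Gatermann–Parrilo Thm 3.3 at the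
  `T1`/`T2′` rung for any finite group acting by a (spin-preserving) UNITARY REPRESENTATION
  `ρ : G →* Matrix (Orb Λ) (Orb Λ) ℂ` leaving the functional invariant: `c ≤ E_PQGT1T2′` iff `c` lies
  below the functional on the `ρ`-INVARIANT feasible pairs; an invariant minimiser exists — symmetry
  adaptation to the full (possibly non-abelian) point group loses nothing at the cell's strongest rung.

Everything is PROVED (0 sorry, standard axioms); no definitions, no named facts; nothing asserts a bound
about any model; no claim node, no hint / row depends on it. NOT here: the exact side
`E₀(Ĥ(h', g')) = E₀(Ĥ(h, g))` (Bogoliubov lift on the Fock space); the explicit block structure of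
invariant pairs (Schur's lemma).

References: K. Gatermann, P. A. Parrilo, J. Pure Appl. Algebra 192 (2004) 95–128, §3 Thm 3.3;
M. Nakata et al., J. Chem. Phys. 128 (2008) 164113 §II.A–C; D. A. Mazziotti, Adv. Chem. Phys. 134
(2007) ch. 3 §II.F–G; P. W. Ayers, E. R. Davidson, ibid. ch. 16 §III.F eqs. (56)–(57).

Tree (REUSED): `isDQGT1T2PrimeFeasible_conj_unitary` (`Rows/OrbitalRotationCovarianceT`);
`isDQGFeasibleSector_conj_unitary`, `rdmEnergy_conj_orbital`, `spin_sel_of_orbital`,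
`kronecker_mul_conjTranspose_of_unitary`, `rotationAverage_one_conj`, `rotationAverage_two_conj`,
`rdmEnergy_rotationAverage` (this seat's rotation files); `IsDQGT1T2PrimeFeasible(Sector).sum_smul`,
`pqgT1T2p(Sector)EnergySet_bddBelow/_nonempty`, `exists_isDQGT1T2PrimeFeasibleSector_rdmEnergy_eq_…`
(typer). Mathlib: `mul_eq_one_comm`, `le_csInf_iff`.
-/

noncomputable section

namespace Summit.Ventures.CertifiedQuantumChemistry

open Matrix Finset
open Literature.MathematicalPhysics.QuantumLattice Literature.MathematicalPhysics.QuantumChemistry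
open scoped ComplexOrder Kronecker

variable {Λ : Type*} [LinearOrder Λ] [Fintype Λ]

/-! ## §1 Invariance of the sector `PQGT1T2′`-feasible set -/

/-- **The `S_z`-sector `PQGT1T2′`-feasible set is invariant under spin-preserving unitary rotations.** -/
theorem isDQGT1T2PrimeFeasibleSector_conj_unitary {U : Matrix (Orb Λ) (Orb Λ) ℂ} (hU : U * Uᴴ = 1)
    (hspin : ∀ i k : Orb Λ, (ofLex i).2 ≠ (ofLex k).2 → U i k = 0) {a b : ℕ}
    {γ : Matrix (Orb Λ) (Orb Λ) ℂ} {Γ : Matrix (Orb Λ × Orb Λ) (Orb Λ × Orb Λ) ℂ}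
    (h : IsDQGT1T2PrimeFeasibleSector a b γ Γ) :
    IsDQGT1T2PrimeFeasibleSector a b (U * γ * Uᴴ) (U ⊗ₖ U * Γ * (U ⊗ₖ U)ᴴ) where
  toIsDQGFeasibleSector := isDQGFeasibleSector_conj_unitary hU hspin h.toIsDQGFeasibleSector
  t1_psd := (isDQGT1T2PrimeFeasible_conj_unitary hU h.isDQGT1T2PrimeFeasible).t1_psd
  t2Prime_psd := (isDQGT1T2PrimeFeasible_conj_unitary hU h.isDQGT1T2PrimeFeasible).t2Prime_psd

/-! ## §2 Invariance of the optimal values `E_PQGT1T2′` -/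

/-- **`E_PQGT1T2′(N_α, N_β)` IS AN ORBITAL-ROTATION INVARIANT** of the integral tables (unitary `u`
with spin-free lift `U`; rotated tables as in `rdmEnergy_conj_orbital`). -/
theorem pqgT1T2pSectorEnergy_conj_orbital {U : Matrix (Orb Λ) (Orb Λ) ℂ} {u : Matrix Λ Λ ℂ}
    (hU : U * Uᴴ = 1) (hUu : ∀ p q σ τ, U (orb p σ) (orb q τ) = if σ = τ then u p q else 0)
    (h : Λ → Λ → ℂ) (g : Λ → Λ → Λ → Λ → ℂ) (hnuc : ℂ) (a b : ℕ) :
    pqgT1T2pSectorEnergy h g hnuc a b =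
      pqgT1T2pSectorEnergy (fun a b => ∑ p, ∑ q, u p a * star (u q b) * h p q)
        (fun a b c d => ∑ p, ∑ q, ∑ r, ∑ s, u p a * star (u q b) * u r c * star (u s d) * g p q r s)
        hnuc a b := by
  have hspin := spin_sel_of_orbital hUu
  have hU' : Uᴴ * U = 1 := mul_eq_one_comm.mp hU
  have hW : U ⊗ₖ U * (U ⊗ₖ U)ᴴ = 1 := kronecker_mul_conjTranspose_of_unitary hU U hU
  unfold pqgT1T2pSectorEnergy
  congr 1
  ext E
  constructor
  · rintro ⟨γ, Γ, hf, rfl⟩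
    refine ⟨Uᴴ * γ * U, (U ⊗ₖ U)ᴴ * Γ * (U ⊗ₖ U), ?_, ?_⟩
    · have hf' := isDQGT1T2PrimeFeasibleSector_conj_unitary (U := Uᴴ)
        (by rw [conjTranspose_conjTranspose, hU'])
        (fun i k hik => by rw [conjTranspose_apply, hspin k i (Ne.symm hik), star_zero]) hf
      simpa only [conjTranspose_conjTranspose, ← conjTranspose_kronecker] using hf'
    · have hγ : U * (Uᴴ * γ * U) * Uᴴ = γ := by
        simp only [← Matrix.mul_assoc]
        rw [hU, Matrix.one_mul, Matrix.mul_assoc, hU, Matrix.mul_one]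
      have hΓ : U ⊗ₖ U * ((U ⊗ₖ U)ᴴ * Γ * (U ⊗ₖ U)) * (U ⊗ₖ U)ᴴ = Γ := by
        simp only [← Matrix.mul_assoc]
        rw [hW, Matrix.one_mul, Matrix.mul_assoc, hW, Matrix.mul_one]
      rw [← rdmEnergy_conj_orbital hUu, hγ, hΓ]
  · rintro ⟨γ, Γ, hf, rfl⟩
    exact ⟨U * γ * Uᴴ, U ⊗ₖ U * Γ * (U ⊗ₖ U)ᴴ, isDQGT1T2PrimeFeasibleSector_conj_unitary hU hspin hf,
      by rw [rdmEnergy_conj_orbital hUu]⟩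

/-- **`E_PQGT1T2′(N)` IS AN ORBITAL-ROTATION INVARIANT** of the integral tables. -/
theorem pqgT1T2pEnergy_conj_orbital {U : Matrix (Orb Λ) (Orb Λ) ℂ} {u : Matrix Λ Λ ℂ}
    (hU : U * Uᴴ = 1) (hUu : ∀ p q σ τ, U (orb p σ) (orb q τ) = if σ = τ then u p q else 0)
    (h : Λ → Λ → ℂ) (g : Λ → Λ → Λ → Λ → ℂ) (hnuc : ℂ) (N : ℕ) :
    pqgT1T2pEnergy h g hnuc N =
      pqgT1T2pEnergy (fun a b => ∑ p, ∑ q, u p a * star (u q b) * h p q)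
        (fun a b c d => ∑ p, ∑ q, ∑ r, ∑ s, u p a * star (u q b) * u r c * star (u s d) * g p q r s)
        hnuc N := by
  have hU' : Uᴴ * U = 1 := mul_eq_one_comm.mp hU
  have hW : U ⊗ₖ U * (U ⊗ₖ U)ᴴ = 1 := kronecker_mul_conjTranspose_of_unitary hU U hU
  unfold pqgT1T2pEnergy
  congr 1
  ext E
  constructor
  · rintro ⟨γ, Γ, hf, rfl⟩
    refine ⟨Uᴴ * γ * U, (U ⊗ₖ U)ᴴ * Γ * (U ⊗ₖ U), ?_, ?_⟩
    · have hf' := isDQGT1T2PrimeFeasible_conj_unitary (U := Uᴴ)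
        (by rw [conjTranspose_conjTranspose, hU']) hf
      simpa only [conjTranspose_conjTranspose, ← conjTranspose_kronecker] using hf'
    · have hγ : U * (Uᴴ * γ * U) * Uᴴ = γ := by
        simp only [← Matrix.mul_assoc]
        rw [hU, Matrix.one_mul, Matrix.mul_assoc, hU, Matrix.mul_one]
      have hΓ : U ⊗ₖ U * ((U ⊗ₖ U)ᴴ * Γ * (U ⊗ₖ U)) * (U ⊗ₖ U)ᴴ = Γ := by
        simp only [← Matrix.mul_assoc]
        rw [hW, Matrix.one_mul, Matrix.mul_assoc, hW, Matrix.mul_one]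
      rw [← rdmEnergy_conj_orbital hUu, hγ, hΓ]
  · rintro ⟨γ, Γ, hf, rfl⟩
    exact ⟨U * γ * Uᴴ, U ⊗ₖ U * Γ * (U ⊗ₖ U)ᴴ, isDQGT1T2PrimeFeasible_conj_unitary hU hf,
      by rw [rdmEnergy_conj_orbital hUu]⟩

/-! ## §3 Gatermann–Parrilo Thm 3.3 at the `T1`/`T2′` rung for unitary representations -/

variable {G : Type*} [Group G] [Fintype G]

/-- The uniform weights `1/|G|` sum to one. -/
private theorem sum_card_inv_eq_one'' : ∑ _g : G, ((Fintype.card G : ℝ)⁻¹ : ℝ) = 1 := by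
  rw [Finset.sum_const, Finset.card_univ, nsmul_eq_mul,
    mul_inv_cancel₀ (Nat.cast_ne_zero.mpr (Fintype.card_pos_iff.mpr ⟨1⟩).ne')]

/-- **The rotation average of a `PQGT1T2′`-feasible pair is `PQGT1T2′`-feasible** (`N`-electron). -/
theorem isDQGT1T2PrimeFeasible_rotationAverage (ρ : G →* Matrix (Orb Λ) (Orb Λ) ℂ)
    (hρ : ∀ g, ρ g * (ρ g)ᴴ = 1) {N : ℕ} {γ : Matrix (Orb Λ) (Orb Λ) ℂ}
    {Γ : Matrix (Orb Λ × Orb Λ) (Orb Λ × Orb Λ) ℂ} (h : IsDQGT1T2PrimeFeasible N γ Γ) :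
    IsDQGT1T2PrimeFeasible N (∑ g : G, (((Fintype.card G : ℝ)⁻¹ : ℝ) : ℂ) • (ρ g * γ * (ρ g)ᴴ))
      (∑ g : G, (((Fintype.card G : ℝ)⁻¹ : ℝ) : ℂ) • (ρ g ⊗ₖ ρ g * Γ * (ρ g ⊗ₖ ρ g)ᴴ)) :=
  IsDQGT1T2PrimeFeasible.sum_smul Finset.univ (fun _ => (Fintype.card G : ℝ)⁻¹)
    (fun _ _ => inv_nonneg.mpr (Nat.cast_nonneg _)) sum_card_inv_eq_one''
    fun g _ => isDQGT1T2PrimeFeasible_conj_unitary (hρ g) h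

/-- **The rotation average of a sector-`PQGT1T2′`-feasible pair is sector-`PQGT1T2′`-feasible.** -/
theorem isDQGT1T2PrimeFeasibleSector_rotationAverage (ρ : G →* Matrix (Orb Λ) (Orb Λ) ℂ)
    (hρ : ∀ g, ρ g * (ρ g)ᴴ = 1) (hspin : ∀ g (i k : Orb Λ), (ofLex i).2 ≠ (ofLex k).2 → ρ g i k = 0)
    {a b : ℕ} {γ : Matrix (Orb Λ) (Orb Λ) ℂ} {Γ : Matrix (Orb Λ × Orb Λ) (Orb Λ × Orb Λ) ℂ}
    (h : IsDQGT1T2PrimeFeasibleSector a b γ Γ) :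
    IsDQGT1T2PrimeFeasibleSector a b
      (∑ g : G, (((Fintype.card G : ℝ)⁻¹ : ℝ) : ℂ) • (ρ g * γ * (ρ g)ᴴ))
      (∑ g : G, (((Fintype.card G : ℝ)⁻¹ : ℝ) : ℂ) • (ρ g ⊗ₖ ρ g * Γ * (ρ g ⊗ₖ ρ g)ᴴ)) :=
  IsDQGT1T2PrimeFeasibleSector.sum_smul Finset.univ (fun _ => (Fintype.card G : ℝ)⁻¹)
    (fun _ _ => inv_nonneg.mpr (Nat.cast_nonneg _)) sum_card_inv_eq_one''
    fun g _ => isDQGT1T2PrimeFeasibleSector_conj_unitary (hρ g) (hspin g) h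

/-- **Thm 3.3 at the `T1`/`T2′` rung (`N`-electron form)**: `c ≤ E_PQGT1T2′(N)` iff `c` lies below the
`ρ`-invariant functional on the `ρ`-INVARIANT `PQGT1T2′`-feasible pairs (`N ≤ 2|Λ|`). -/
theorem le_pqgT1T2pEnergy_iff_rotationInvariant (h : Λ → Λ → ℂ) (g₂ : Λ → Λ → Λ → Λ → ℂ)
    (hnuc : ℂ) {N : ℕ} (hN : N ≤ Fintype.card (Orb Λ)) (ρ : G →* Matrix (Orb Λ) (Orb Λ) ℂ)
    (hρ : ∀ g, ρ g * (ρ g)ᴴ = 1)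
    (hE : ∀ (g : G) (γ : Matrix (Orb Λ) (Orb Λ) ℂ) (Γ : Matrix (Orb Λ × Orb Λ) (Orb Λ × Orb Λ) ℂ),
      rdmEnergy h g₂ hnuc (ρ g * γ * (ρ g)ᴴ) (ρ g ⊗ₖ ρ g * Γ * (ρ g ⊗ₖ ρ g)ᴴ) =
        rdmEnergy h g₂ hnuc γ Γ) (c : ℝ) :
    c ≤ pqgT1T2pEnergy h g₂ hnuc N ↔
      ∀ γ Γ, IsDQGT1T2PrimeFeasible N γ Γ →
        (∀ g : G, ρ g * γ * (ρ g)ᴴ = γ ∧ ρ g ⊗ₖ ρ g * Γ * (ρ g ⊗ₖ ρ g)ᴴ = Γ) →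
        c ≤ (rdmEnergy h g₂ hnuc γ Γ).re := by
  rw [pqgT1T2pEnergy, le_csInf_iff (pqgT1T2pEnergySet_bddBelow h g₂ hnuc N)
    (pqgT1T2pEnergySet_nonempty h g₂ hnuc hN)]
  constructor
  · rintro hc γ Γ hf -
    exact hc _ ⟨γ, Γ, hf, rfl⟩
  · rintro hc E ⟨γ, Γ, hf, rfl⟩
    rw [← rdmEnergy_rotationAverage h g₂ hnuc ρ hE γ Γ]
    exact hc _ _ (isDQGT1T2PrimeFeasible_rotationAverage ρ hρ hf) fun g =>
      ⟨rotationAverage_one_conj ρ _ γ g, rotationAverage_two_conj ρ _ Γ g⟩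

/-- **Thm 3.3 at the `T1`/`T2′` rung (sector form)**: `c ≤ E_PQGT1T2′(N_α, N_β)` iff `c` lies below
the functional on the `ρ`-INVARIANT sector-`PQGT1T2′`-feasible pairs (`a, b ≤ |Λ|`). -/
theorem le_pqgT1T2pSectorEnergy_iff_rotationInvariant (h : Λ → Λ → ℂ) (g₂ : Λ → Λ → Λ → Λ → ℂ)
    (hnuc : ℂ) {a b : ℕ} (ha : a ≤ Fintype.card Λ) (hb : b ≤ Fintype.card Λ)
    (ρ : G →* Matrix (Orb Λ) (Orb Λ) ℂ) (hρ : ∀ g, ρ g * (ρ g)ᴴ = 1)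
    (hspin : ∀ g (i k : Orb Λ), (ofLex i).2 ≠ (ofLex k).2 → ρ g i k = 0)
    (hE : ∀ (g : G) (γ : Matrix (Orb Λ) (Orb Λ) ℂ) (Γ : Matrix (Orb Λ × Orb Λ) (Orb Λ × Orb Λ) ℂ),
      rdmEnergy h g₂ hnuc (ρ g * γ * (ρ g)ᴴ) (ρ g ⊗ₖ ρ g * Γ * (ρ g ⊗ₖ ρ g)ᴴ) =
        rdmEnergy h g₂ hnuc γ Γ) (c : ℝ) :
    c ≤ pqgT1T2pSectorEnergy h g₂ hnuc a b ↔
      ∀ γ Γ, IsDQGT1T2PrimeFeasibleSector a b γ Γ →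
        (∀ g : G, ρ g * γ * (ρ g)ᴴ = γ ∧ ρ g ⊗ₖ ρ g * Γ * (ρ g ⊗ₖ ρ g)ᴴ = Γ) →
        c ≤ (rdmEnergy h g₂ hnuc γ Γ).re := by
  rw [pqgT1T2pSectorEnergy, le_csInf_iff (pqgT1T2pSectorEnergySet_bddBelow h g₂ hnuc a b)
    (pqgT1T2pSectorEnergySet_nonempty h g₂ hnuc ha hb)]
  constructor
  · rintro hc γ Γ hf -
    exact hc _ ⟨γ, Γ, hf, rfl⟩
  · rintro hc E ⟨γ, Γ, hf, rfl⟩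
    rw [← rdmEnergy_rotationAverage h g₂ hnuc ρ hE γ Γ]
    exact hc _ _ (isDQGT1T2PrimeFeasibleSector_rotationAverage ρ hρ hspin hf) fun g =>
      ⟨rotationAverage_one_conj ρ _ γ g, rotationAverage_two_conj ρ _ Γ g⟩

/-- **An invariant `PQGT1T2′` minimiser exists** (sector form, with the typer's attainment theorem). -/
theorem exists_rotationInvariant_rdmEnergy_eq_pqgT1T2pSectorEnergy (h : Λ → Λ → ℂ)
    (g₂ : Λ → Λ → Λ → Λ → ℂ) (hnuc : ℂ) {a b : ℕ} (ha : a ≤ Fintype.card Λ) (hb : b ≤ Fintype.card Λ)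
    (ρ : G →* Matrix (Orb Λ) (Orb Λ) ℂ) (hρ : ∀ g, ρ g * (ρ g)ᴴ = 1)
    (hspin : ∀ g (i k : Orb Λ), (ofLex i).2 ≠ (ofLex k).2 → ρ g i k = 0)
    (hE : ∀ (g : G) (γ : Matrix (Orb Λ) (Orb Λ) ℂ) (Γ : Matrix (Orb Λ × Orb Λ) (Orb Λ × Orb Λ) ℂ),
      rdmEnergy h g₂ hnuc (ρ g * γ * (ρ g)ᴴ) (ρ g ⊗ₖ ρ g * Γ * (ρ g ⊗ₖ ρ g)ᴴ) =
        rdmEnergy h g₂ hnuc γ Γ) :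
    ∃ γ Γ, IsDQGT1T2PrimeFeasibleSector a b γ Γ ∧
      (∀ g : G, ρ g * γ * (ρ g)ᴴ = γ ∧ ρ g ⊗ₖ ρ g * Γ * (ρ g ⊗ₖ ρ g)ᴴ = Γ) ∧
      (rdmEnergy h g₂ hnuc γ Γ).re = pqgT1T2pSectorEnergy h g₂ hnuc a b := by
  obtain ⟨γ, Γ, hf, hEq⟩ :=
    exists_isDQGT1T2PrimeFeasibleSector_rdmEnergy_eq_pqgT1T2pSectorEnergy h g₂ hnuc ha hb
  exact ⟨_, _, isDQGT1T2PrimeFeasibleSector_rotationAverage ρ hρ hspin hf,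
    fun g => ⟨rotationAverage_one_conj ρ _ γ g, rotationAverage_two_conj ρ _ Γ g⟩,
    by rw [rdmEnergy_rotationAverage h g₂ hnuc ρ hE γ Γ, hEq]⟩

end Summit.Ventures.CertifiedQuantumChemistry

end
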